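import Mathlib
import Literature.MathematicalPhysics.StatisticalMechanics.Crystallization

/-!
# Crux `ExactCertificate` (stmt-AtomisticToContinuum-11959), line `closure-makes-nogap-exact`,
# skeleton X (`AllTemplates`): stub `stub_structureFactorWindows` (X2)

Support file for the crux `ThreeConeCertificate.ExactCertificate`, skeleton X
(`Cruxes.ExactCertificate.AllTemplates`: the commensurability caveat of skeletons VIII–IX removed
by a Vandermonde window argument).  Given the window statement for exponential sums (stub X1,
`stub_expSumWindow`, taken verbatim as a hypothesis), the structure factor of a periodic
configuration `P ⊂ ℝ³`,
`S(n, j) = Σ_{x ∈ motif} e^{−2πi⟨x, n k₁ + j k₂⟩}`, is WINDOW-DENSE non-vanishing on every plane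
`{n k₁ + j k₂}`: with `μ := #motif`, every window of `μ` consecutive `j` contains a line `j` on
which `S(·, j)` is non-zero somewhere in every window of `μ` consecutive `n`.  No lattice or
duality hypothesis is used (`k₁, k₂` arbitrary).

Proof.  With the unimodular nodes `α x := e^{−2πi⟨x, k₁⟩}`, `β x := e^{−2πi⟨x, k₂⟩}` one has
`S(n, j) = Σ_{x ∈ motif} (α x)^n (β x)^j` (`Complex.exp_int_mul`).  Fix `x₀ ∈ motif` and its class
`A := {x ∈ motif | α x = α x₀}`.  Grouping `Σ_{x ∈ A} (β x)^j` by the value of `β` gives an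
exponential sum over `#(β '' A) ≤ μ` non-zero nodes with positive integer coefficients, so X1
gives `j ∈ [j₀, j₀ + μ)` with `T := Σ_{x ∈ A} (β x)^j ≠ 0`.  On that line, grouping `S(n, j)` by the
value of `α` gives an exponential sum over `#(α '' motif) ≤ μ` non-zero nodes whose coefficient at
`α x₀` is `T ≠ 0`, so X1 gives a non-zero value in every window of `μ` consecutive `n`
(`Finset.sum_fiberwise_of_maps_to`).  Pure Mathlib, private helpers only.  All `[folklore]`.
-/

noncomputable section

namespace Summit.AtomisticToContinuum.Crystallization.Theorems.ThreeConeCertificateExactCertificate.AllTemplates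

open Literature.MathematicalPhysics.StatisticalMechanics
open scoped BigOperators RealInnerProductSpace

/-- Grouping an exponential sum by its nodes: for a finite index set `F`, nodes `α : ι → ℂ` and
weights `w`, `Σ_{a ∈ α '' F} (Σ_{x ∈ F, α x = a} w x) · aⁿ = Σ_{x ∈ F} (α x)ⁿ · w x`. [folklore] -/
private theorem sum_group {ι : Type*} (F : Finset ι) (α : ι → ℂ) (w : ι → ℂ) (n : ℤ) :
    ∑ a ∈ F.image α, (∑ x ∈ F.filter (fun x => α x = a), w x) * a ^ n =
      ∑ x ∈ F, α x ^ n * w x := by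
  rw [← Finset.sum_fiberwise_of_maps_to (fun x hx => Finset.mem_image_of_mem α hx)
    (fun x => α x ^ n * w x)]
  refine Finset.sum_congr rfl fun a _ => ?_
  rw [Finset.sum_mul]
  refine Finset.sum_congr rfl fun x hx => ?_
  rw [(Finset.mem_filter.1 hx).2, mul_comm]

/-- The combinatorial core: GIVEN the window statement for exponential sums (stub X1), for a
finite index set `F ∋ x₀` and non-vanishing node maps `α, β : ι → ℂ`, every window of `#F`
consecutive `j` contains a `j` such that `n ↦ Σ_{x ∈ F} (α x)ⁿ (β x)ʲ` is non-zero somewhere in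
every window of `#F` consecutive `n` (group by the class of `x₀` under `α`, then by the value of
`α`). [folklore] -/
private theorem core {ι : Type*}
    (hX1 : ∀ (s : Finset ℂ) (C : ℂ → ℂ), (∀ a ∈ s, a ≠ 0) → (∃ a ∈ s, C a ≠ 0) →
      ∀ n₀ : ℤ, ∃ n : ℤ, n₀ ≤ n ∧ n < n₀ + s.card ∧ ∑ a ∈ s, C a * a ^ n ≠ 0)
    (F : Finset ι) {x₀ : ι} (hx₀ : x₀ ∈ F) (α β : ι → ℂ) (hα : ∀ x, α x ≠ 0) (hβ : ∀ x, β x ≠ 0)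
    (j₀ : ℤ) :
    ∃ j : ℤ, j₀ ≤ j ∧ j < j₀ + F.card ∧
      ∀ n₀ : ℤ, ∃ n : ℤ, n₀ ≤ n ∧ n < n₀ + F.card ∧ ∑ x ∈ F, α x ^ n * β x ^ j ≠ 0 := by
  -- STEP 1: a good line in every `j`-window, from the class `A` of `x₀` under `α`
  obtain ⟨A, hA⟩ : ∃ A : Finset ι, A = F.filter (fun x => α x = α x₀) := ⟨_, rfl⟩
  have hx₀A : x₀ ∈ A := hA ▸ Finset.mem_filter.2 ⟨hx₀, rfl⟩
  have hAF : A.card ≤ F.card := hA ▸ Finset.card_filter_le _ _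
  have hnodes₁ : ∀ a ∈ A.image β, a ≠ 0 := by
    intro a ha
    obtain ⟨x, -, rfl⟩ := Finset.mem_image.1 ha
    exact hβ x
  have hcoef₁ : ∃ a ∈ A.image β, (∑ _x ∈ A.filter (fun x => β x = a), (1 : ℂ)) ≠ 0 := by
    refine ⟨β x₀, Finset.mem_image_of_mem β hx₀A, ?_⟩
    rw [Finset.sum_const, nsmul_eq_mul, mul_one, Nat.cast_ne_zero]
    exact Finset.card_ne_zero_of_mem (Finset.mem_filter.2 ⟨hx₀A, rfl⟩)
  obtain ⟨j, hj₀, hj₁, hT⟩ :=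
    hX1 (A.image β) (fun a => ∑ _x ∈ A.filter (fun x => β x = a), (1 : ℂ)) hnodes₁ hcoef₁ j₀
  rw [sum_group A β (fun _ => (1 : ℂ)) j] at hT
  simp only [mul_one] at hT
  -- `hT : Σ_{x ∈ A} (β x)^j ≠ 0`, and `#(β '' A) ≤ #A ≤ #F`
  have hcard₁ : (A.image β).card ≤ F.card := Finset.card_image_le.trans hAF
  refine ⟨j, hj₀, by omega, fun n₀ => ?_⟩
  -- STEP 2: on the line `j`, group `S(n, j)` by the value of `α`; the coefficient at `α x₀` is `T`
  have hnodes₂ : ∀ a ∈ F.image α, a ≠ 0 := by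
    intro a ha
    obtain ⟨x, -, rfl⟩ := Finset.mem_image.1 ha
    exact hα x
  have hcoef₂ : ∃ a ∈ F.image α, (∑ x ∈ F.filter (fun x => α x = a), β x ^ j) ≠ 0 :=
    ⟨α x₀, Finset.mem_image_of_mem α hx₀, hA ▸ hT⟩
  obtain ⟨n, hn₀, hn₁, hS⟩ :=
    hX1 (F.image α) (fun a => ∑ x ∈ F.filter (fun x => α x = a), β x ^ j) hnodes₂ hcoef₂ n₀
  rw [sum_group F α (fun x => β x ^ j) n] at hS
  have hcard₂ : (F.image α).card ≤ F.card := Finset.card_image_le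
  exact ⟨n, hn₀, by omega, hS⟩

/-- The key identity: the structure-factor summand factors through the unimodular nodes,
`e^{−2πi⟨x, n k₁ + j k₂⟩} = (e^{−2πi⟨x, k₁⟩})ⁿ (e^{−2πi⟨x, k₂⟩})ʲ` (integer powers). [folklore] -/
private theorem summand_eq (x k₁ k₂ : EuclideanSpace ℝ (Fin 3)) (n j : ℤ) :
    Complex.exp (↑(-2 * Real.pi * ⟪x, (n : ℝ) • k₁ + (j : ℝ) • k₂⟫) * Complex.I) =
      Complex.exp (↑(-2 * Real.pi * ⟪x, k₁⟫) * Complex.I) ^ n *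
        Complex.exp (↑(-2 * Real.pi * ⟪x, k₂⟫) * Complex.I) ^ j := by
  rw [← Complex.exp_int_mul, ← Complex.exp_int_mul, ← Complex.exp_add, inner_add_right,
    real_inner_smul_right, real_inner_smul_right]
  congr 1
  push_cast
  ring

/-- Stub X2 (structure factor is window-dense on every dual plane).  GIVEN the window statement
for exponential sums (the statement of stub `stub_expSumWindow`, taken verbatim as a
hypothesis), for every periodic `P ⊂ ℝ³`, all `k₁, k₂` and every `j₀` there is
`j ∈ [j₀, j₀ + #motif)` such that on the line `j` the structure factor
`Σ_{x ∈ motif} e^{−2πi⟨x, n k₁ + j k₂⟩}` is non-zero for some `n` in EVERY window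
`[n₀, n₀ + #motif)`. [folklore] -/
theorem stub_structureFactorWindows : (∀ (s : Finset ℂ) (C : ℂ → ℂ), (∀ a ∈ s, a ≠ 0) → (∃ a ∈ s, C a ≠ 0) →
      ∀ n₀ : ℤ, ∃ n : ℤ, n₀ ≤ n ∧ n < n₀ + s.card ∧ ∑ a ∈ s, C a * a ^ n ≠ 0) →
    ∀ (P : Literature.MathematicalPhysics.StatisticalMechanics.PeriodicConfiguration 3) (k₁ k₂ : EuclideanSpace ℝ (Fin 3)) (j₀ : ℤ),
    ∃ j : ℤ, j₀ ≤ j ∧ j < j₀ + P.motif.card ∧ ∀ n₀ : ℤ, ∃ n : ℤ, n₀ ≤ n ∧ n < n₀ + P.motif.card ∧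
      (∑ x ∈ P.motif, Complex.exp (↑(-2 * Real.pi * inner ℝ x ((n : ℝ) • k₁ + (j : ℝ) • k₂)) * Complex.I)) ≠ 0 := by
  intro hX1 P k₁ k₂ j₀
  obtain ⟨x₀, hx₀⟩ := P.motif_nonempty
  obtain ⟨j, hj₀, hj₁, hwin⟩ := core hX1 P.motif hx₀
    (fun x => Complex.exp (↑(-2 * Real.pi * ⟪x, k₁⟫) * Complex.I))
    (fun x => Complex.exp (↑(-2 * Real.pi * ⟪x, k₂⟫) * Complex.I))
    (fun _ => Complex.exp_ne_zero _) (fun _ => Complex.exp_ne_zero _) j₀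
  refine ⟨j, hj₀, hj₁, fun n₀ => ?_⟩
  obtain ⟨n, hn₀, hn₁, hS⟩ := hwin n₀
  refine ⟨n, hn₀, hn₁, ?_⟩
  rwa [Finset.sum_congr rfl fun x _ => summand_eq x k₁ k₂ n j]

end Summit.AtomisticToContinuum.Crystallization.Theorems.ThreeConeCertificateExactCertificate.AllTemplates
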